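import Literature.AlgebraicGeometry.CubicSurfaces.OccultSystem
import Literature.AlgebraicGeometry.CubicSurfaces.SchlafliFrame
import Mathlib.NumberTheory.NumberField.Cyclotomic.Ideal
import HarnessLib

/-!
# The occult compatible system of a cubic surface — proved ingredients

Companion (proof file, D-0014/D-0026: theorems only, no new named fact) of
`Literature/AlgebraicGeometry/CubicSurfaces/OccultSystem.lean`, whose named fact
`CubicSurface.exists_occultSystem` [AllcockCarlsonToledo2002, (2.2), (2.7), (2.12), (4.8)–(4.10);
Achter2014, Lemma 4.4, Prop 4.5; Deligne1974, Thm 1.6] is the `λ`-adic shadow of the occult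
Eisenstein lattice `Λ(T) = H³(T, ℤ) ≅ ℤ[ω]^{4,1}` of the cyclic cubic threefold `T_S → ℙ³`
branched along the smooth cubic surface `S`.  Its discharge needs the `λ`-adic étale `H³` of
`T_S` over `ℚ(ω)` for every finite place `λ` (continuity, smooth-proper base change,
`ℓ`-independence of the Frobenius polynomials, purity, Poincaré duality, comparison with the
Betti lattice) together with the `27` lines (`dim V(S) = 5`) — carriers the tree does not have
yet (triage in the prover's notes: SIZE XL).  What IS provable now, and is proved here, are the
elementary ingredients of clauses (2) and (3) of the interface `CubicSurface.IsOccultSystem` that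
its module docstring invokes:

* **the prime `λ₃ = (1 - ω)`**: in any third cyclotomic field `L = ℚ(ζ₃)` the ideal `(ζ₃ - 1)`
  has absolute norm `3` and contains `3` (`absNorm_span_zeta_three_sub_one`); a finite place
  containing `3` exists and is unique (`existsUnique_heightOneSpectrum_three_mem`); its residue
  ring has three elements and is `𝔽₃` (`card_quot_eq_three_of_three_mem`,
  `nonempty_zmod_ringEquiv_quot_of_three_mem`); hence the `∃ λ ∋ 3, j : 𝔽₃ →+* 𝓞_E/λ` of
  clause (3) is realised, uniquely, with `j` an isomorphism
  (`exists_heightOneSpectrum_three_mem`) [AllcockCarlsonToledo2002, (2.12): "`𝓔/θ𝓔` is the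
  field `𝔽₃` of three elements"] — via Mathlib's
  `IsCyclotomicExtension.Rat.absNorm_span_zeta_sub_one`, `p_mem_span_zeta_sub_one`,
  `eq_span_zeta_sub_one_of_liesOver'`;
* **orthogonality**: in any basis of the quadratic space `V(F)` of the lines, `σ` and `σ⁻¹` have
  the same characteristic polynomial (`charpoly_toMatrix_linesQuadRep_inv`), because the action
  is `q`-orthogonal (`linesQuadForm_linesQuadRep`) and `q` is nondegenerate
  (`linesQuadForm_nondegenerate`): `g⁻¹ = B⁻¹ gᵀ B`.  This is why clause (3) is insensitive to
  arithmetic versus geometric Frobenius (`charpoly_toMatrix_linesQuadRep_absGaloisRestrict_inv`)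
  [AllcockCarlsonToledo2002, (2.12), (4.8): `Aut(V, q)` is an orthogonal group];
* **the algebra of clause (2)**: for a split `P = ∏ᵢ (X - βᵢ)` with nonzero roots and `c ≠ 0`,
  `P(0)⁻¹ · reverse(P(cX)) = ∏ᵢ (X - c/βᵢ)` (`C_inv_coeff_zero_mul_reverse_comp_prod_X_sub_C`),
  whence the roots of an occult system at the conjugate place are the `(N v)³/βᵢ`
  (`IsOccultSystem.charpoly_conj_eq_prod`) [AllcockCarlsonToledo2002, (2.3)–(2.4)]; and the two
  places of clause (2) have the same norm, `N(τ⁻¹ v) = N v` (`residueCard_eq_of_asIdeal_eq_comap`,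
  `IsOccultSystem.polarised'`);
* **clause (3) through a marking of the `27` lines** (`SchlafliFrame.lean`): with a marking `m` of
  the lines over `ℚ̄` the basis of clause (3) is `m.basis = ([E_i] - [F_{i5}])_i`
  [Achter2014, Lemma 4.4] and the matrix of `σ` in it is `frameMatrix (m.perm σ|_{ℚ̄})`, so the
  clause is established from integral lifts reducing to the characteristic polynomials of these
  explicit matrices (`residual_of_marking`, `isOccultSystem_of_marking`) and, conversely, an
  occult system computes them for every marking (`IsOccultSystem.residual_frameMatrix`): the
  residual clause is a statement about the permutation action of Frobenius on the `27` lines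
  (`charpoly_toMatrix_linesQuadRep_absGaloisRestrict_congr`) [Achter2014, Prop 4.5].

## References

* [AllcockCarlsonToledo2002] D. Allcock, J. Carlson, D. Toledo, *The complex hyperbolic geometry
  of the moduli space of cubic surfaces*, J. Algebraic Geom. 11 (2002) 659–724: (2.3)–(2.4)
  (the Hermitian form from the cup product), (2.12) (`V = Λ/θΛ`, `𝓔/θ𝓔 = 𝔽₃`, `Aut(V, q)`
  orthogonal), (4.8) (`V(S) = L₀(S)/3L₀'(S)`).
* [Achter2014] J. Achter, *Arithmetic Torelli maps for cubic surfaces and threefolds*, Trans.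
  AMS 366 (2014): §2 (markings), §4.2, Lemma 4.4, Prop 4.5.
* L. Washington, *Introduction to Cyclotomic Fields*, GTM 83, Lemma 1.4 (`(1 - ζ_p)` is the
  prime above `p`, totally ramified).
-/

noncomputable section

open Polynomial NumberField IsDedekindDomain Field
open Literature.NumberTheory.GaloisRepresentations

namespace Literature.AlgebraicGeometry.CubicSurfaces

namespace CubicSurface

/-! #### The prime `λ₃ = (ζ₃ - 1)` of `ℚ(ζ₃)` -/

section Lambda3

open IsCyclotomicExtension

variable (L : Type*) [Field L] [NumberField L] [IsCyclotomicExtension {3} ℚ L]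

/-- In `𝓞_{ℚ(ζ₃)}` the ideal `(ζ₃ - 1)` has absolute norm `3` and contains `3`
(`3 = -ζ₃²(1 - ζ₃)²`).  Ref: Allcock–Carlson–Toledo (2002), (2.12) (`𝓔/θ𝓔 = 𝔽₃`,
`θ = ζ₃ - ζ₃⁻¹`); Washington, *Cyclotomic Fields*, Lemma 1.4.
[cite: AllcockCarlsonToledo2002, (2.12)] -/
theorem absNorm_span_zeta_three_sub_one :
    Ideal.absNorm (Ideal.span {(zeta_spec 3 ℚ L).toInteger - 1}) = 3 ∧
      (3 : 𝓞 L) ∈ Ideal.span {(zeta_spec 3 ℚ L).toInteger - 1} := by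
  haveI hL : IsCyclotomicExtension {3 ^ (0 + 1)} ℚ L := by
    rw [zero_add, pow_one]; infer_instance
  have hζ : IsPrimitiveRoot (zeta 3 ℚ L) (3 ^ (0 + 1)) := by
    rw [zero_add, pow_one]; exact zeta_spec 3 ℚ L
  exact ⟨by simpa using IsCyclotomicExtension.Rat.absNorm_span_zeta_sub_one 3 0 hζ,
    by simpa using IsCyclotomicExtension.Rat.p_mem_span_zeta_sub_one 3 0 hζ⟩

variable {L} in
omit [NumberField L] [IsCyclotomicExtension {3} ℚ L] in
/-- A prime of `𝓞_L` containing the rational prime `p` lies over `(p) ⊆ ℤ`. [folklore] -/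
private theorem liesOver_span_of_natCast_mem {P : Ideal (𝓞 L)} [P.IsPrime] {p : ℕ}
    [Fact p.Prime] (hp : (p : 𝓞 L) ∈ P) : P.LiesOver (Ideal.span {(p : ℤ)}) := by
  rw [Ideal.liesOver_iff]
  refine Ideal.IsMaximal.eq_of_le (Int.ideal_span_isMaximal_of_prime p)
    Ideal.IsPrime.ne_top' ?_
  rw [Ideal.span_singleton_le_iff_mem, Ideal.under_def, Ideal.mem_comap, algebraMap_int_eq,
    map_natCast]
  exact hp

/-- **The finite place `λ₃` of `ℚ(ζ₃)` above `3` exists and is unique** (`3` is totally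
ramified: `(3) = (ζ₃ - 1)²`).  Ref: Allcock–Carlson–Toledo (2002), (2.12); Washington,
*Cyclotomic Fields*, Lemma 1.4. [cite: AllcockCarlsonToledo2002, (2.12)] -/
theorem existsUnique_heightOneSpectrum_three_mem :
    ∃! «λ» : HeightOneSpectrum (𝓞 L), (3 : 𝓞 L) ∈ «λ».asIdeal := by
  obtain ⟨-, h3⟩ := absNorm_span_zeta_three_sub_one L
  haveI : (Ideal.span {(zeta_spec 3 ℚ L).toInteger - 1}).IsPrime :=
    IsCyclotomicExtension.Rat.isPrime_span_zeta_sub_one' 3 (zeta_spec 3 ℚ L)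
  refine ⟨⟨Ideal.span {(zeta_spec 3 ℚ L).toInteger - 1}, inferInstance, ?_⟩, h3, ?_⟩
  · exact (Submodule.ne_bot_iff _).mpr ⟨3, h3, by norm_num⟩
  · intro μ hμ
    haveI : μ.asIdeal.LiesOver (Ideal.span {((3 : ℕ) : ℤ)}) :=
      liesOver_span_of_natCast_mem (by simpa using hμ)
    exact HeightOneSpectrum.ext
      (IsCyclotomicExtension.Rat.eq_span_zeta_sub_one_of_liesOver' 3 L (zeta_spec 3 ℚ L)
        μ.asIdeal)

/-- The residue ring of a finite place of `ℚ(ζ₃)` containing `3` has three elements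
(`𝓔/θ𝓔 = 𝔽₃`).  Ref: Allcock–Carlson–Toledo (2002), (2.12).
[cite: AllcockCarlsonToledo2002, (2.12)] -/
theorem card_quot_eq_three_of_three_mem («λ» : HeightOneSpectrum (𝓞 L))
    (h : (3 : 𝓞 L) ∈ «λ».asIdeal) : Nat.card (𝓞 L ⧸ «λ».asIdeal) = 3 := by
  obtain ⟨hN, -⟩ := absNorm_span_zeta_three_sub_one L
  haveI : «λ».asIdeal.LiesOver (Ideal.span {((3 : ℕ) : ℤ)}) :=
    liesOver_span_of_natCast_mem (by simpa using h)
  rw [← Submodule.cardQuot_apply, ← Ideal.absNorm_apply,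
    IsCyclotomicExtension.Rat.eq_span_zeta_sub_one_of_liesOver' 3 L (zeta_spec 3 ℚ L)
      «λ».asIdeal, hN]

/-- The residue field of a finite place of `ℚ(ζ₃)` containing `3` is `𝔽₃ = ZMod 3` (as rings).
Ref: Allcock–Carlson–Toledo (2002), (2.12). [cite: AllcockCarlsonToledo2002, (2.12)] -/
theorem nonempty_zmod_ringEquiv_quot_of_three_mem («λ» : HeightOneSpectrum (𝓞 L))
    (h : (3 : 𝓞 L) ∈ «λ».asIdeal) : Nonempty (ZMod 3 ≃+* 𝓞 L ⧸ «λ».asIdeal) := by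
  have hc := card_quot_eq_three_of_three_mem L «λ» h
  haveI : Finite (𝓞 L ⧸ «λ».asIdeal) := Nat.finite_of_card_ne_zero (by omega)
  letI : Fintype (𝓞 L ⧸ «λ».asIdeal) := Fintype.ofFinite _
  exact ⟨ZMod.ringEquivOfPrime _ Nat.prime_three (by rw [← Nat.card_eq_fintype_card, hc])⟩

/-- The arithmetic skeleton of clause (3) of `IsOccultSystem`: a finite place `λ` of
`E = ℚ(ω) = CyclotomicField 3 ℚ` with `3 ∈ λ` together with a ring homomorphism
`j : 𝔽₃ →+* 𝓞_E/λ` exists (and `λ = λ₃ = (1 - ω)` is unique, `j` an isomorphism, by the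
preceding lemmas).  Ref: Allcock–Carlson–Toledo (2002), (2.12).
[cite: AllcockCarlsonToledo2002, (2.12)] -/
theorem exists_heightOneSpectrum_three_mem :
    ∃ («λ» : HeightOneSpectrum (𝓞 (CyclotomicField 3 ℚ))),
      (3 : 𝓞 (CyclotomicField 3 ℚ)) ∈ «λ».asIdeal ∧
      Nonempty (ZMod 3 →+* 𝓞 (CyclotomicField 3 ℚ) ⧸ «λ».asIdeal) := by
  -- Mathlib's instance is stated for the splitting-field `ℚ`-algebra structure
  -- `CyclotomicField.algebra`, definitionally (not reducibly) equal to `DivisionRing.toRatAlgebra`.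
  haveI : IsCyclotomicExtension {3} ℚ (CyclotomicField 3 ℚ) :=
    CyclotomicField.isCyclotomicExtension 3 ℚ
  obtain ⟨«λ», h3, -⟩ := existsUnique_heightOneSpectrum_three_mem (CyclotomicField 3 ℚ)
  obtain ⟨e⟩ := nonempty_zmod_ringEquiv_quot_of_three_mem (CyclotomicField 3 ℚ) «λ» h3
  exact ⟨«λ», h3, ⟨e.toRingHom⟩⟩

end Lambda3

/-! #### Orthogonality: `σ` and `σ⁻¹` have the same characteristic polynomial on `V(F)` -/

section OrthogonalCharpoly

open scoped Matrix

variable {k : Type*} [Field k] (K : Type*) [Field K] [Algebra k K] (F : MvPolynomial (Fin 4) k)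
variable {G : Type*} [Group G] [MulSemiringAction G K] [SMulCommClass G k K]

/-- **Inverse elements have the same characteristic polynomial on the quadratic space of the
lines.**  For any basis `b` of `V(F)` and any `σ ∈ G`, the matrices of `σ⁻¹` and `σ` in `b` have
the same characteristic polynomial: with `M = [σ]_b`, `B = [q]_b`, `q`-invariance reads
`Mᵀ B M = B`, so `[σ⁻¹]_b = M⁻¹ = B⁻¹ Mᵀ B` (`B` is invertible as `q` is nondegenerate) is
similar to `Mᵀ`.  In particular the Frobenius polynomials on `V(S)` in clause (3) of
`IsOccultSystem` do not distinguish arithmetic from geometric Frobenius.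
Ref: Allcock–Carlson–Toledo (2002), (2.12), (4.8) (`Aut(V, q)` is an orthogonal group).
[cite: AllcockCarlsonToledo2002, (2.12)] -/
theorem charpoly_toMatrix_linesQuadRep_inv {ι : Type*} [Fintype ι] [DecidableEq ι]
    (b : Module.Basis ι (ZMod 3) (LinesQuadSpace K F)) (σ : G) :
    (LinearMap.toMatrix b b (linesQuadRep K F σ⁻¹)).charpoly =
      (LinearMap.toMatrix b b (linesQuadRep K F σ)).charpoly := by
  obtain ⟨M, hM⟩ : ∃ M, M = LinearMap.toMatrix b b (linesQuadRep K F σ) := ⟨_, rfl⟩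
  obtain ⟨M', hM'⟩ : ∃ M', M' = LinearMap.toMatrix b b (linesQuadRep K F σ⁻¹) := ⟨_, rfl⟩
  obtain ⟨B, hB⟩ : ∃ B, B = LinearMap.BilinForm.toMatrix b (linesQuadForm K F) := ⟨_, rfl⟩
  rw [← hM, ← hM']
  -- `q`-invariance in matrix form
  have h1 : Mᵀ * B * M = B := by
    rw [hM, hB, ← LinearMap.BilinForm.toMatrix_comp b b (linesQuadForm K F)
      (linesQuadRep K F σ) (linesQuadRep K F σ)]
    congr 1
    exact LinearMap.BilinForm.ext fun v w => linesQuadForm_linesQuadRep K F σ v w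
  have hMM' : M * M' = 1 := by
    rw [hM, hM', ← LinearMap.toMatrix_mul, ← map_mul, mul_inv_cancel, map_one,
      LinearMap.toMatrix_one]
  have hdet : IsUnit B.det := by
    rw [hB]
    exact isUnit_iff_ne_zero.mpr
      ((LinearMap.BilinForm.nondegenerate_iff_det_ne_zero b).mp (linesQuadForm_nondegenerate K F))
  -- `Mᵀ B = B M⁻¹`, hence `M⁻¹ = B⁻¹ Mᵀ B`
  have h2 : Mᵀ * B = B * M' := by
    calc Mᵀ * B = Mᵀ * B * (M * M') := by rw [hMM', mul_one]
      _ = Mᵀ * B * M * M' := by simp only [mul_assoc]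
      _ = B * M' := by rw [h1]
  have h3 : M' = B⁻¹ * Mᵀ * B := by
    calc M' = B⁻¹ * B * M' := by rw [Matrix.nonsing_inv_mul B hdet, one_mul]
      _ = B⁻¹ * (Mᵀ * B) := by rw [mul_assoc, ← h2]
      _ = B⁻¹ * Mᵀ * B := by rw [mul_assoc]
  calc M'.charpoly = (B⁻¹ * Mᵀ * B).charpoly := by rw [← h3]
    _ = (B * (B⁻¹ * Mᵀ)).charpoly := Matrix.charpoly_mul_comm _ _
    _ = Mᵀ.charpoly := by rw [← mul_assoc, Matrix.mul_nonsing_inv B hdet, one_mul]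
    _ = M.charpoly := Matrix.charpoly_transpose M

end OrthogonalCharpoly

/-! #### The algebra of the polarisation clause: the monic `c`-reciprocal transform -/

section Reciprocal

/-- The reverse of a product of polynomials over a domain is the product of the reverses.
[folklore] -/
private theorem reverse_prod {R : Type*} [CommSemiring R] [NoZeroDivisors R] {ι : Type*}
    (s : Finset ι) (f : ι → R[X]) : (∏ i ∈ s, f i).reverse = ∏ i ∈ s, (f i).reverse := by
  classical
  induction s using Finset.induction_on with
  | empty => rw [Finset.prod_empty, Finset.prod_empty, ← C_1, reverse_C]
  | insert a s ha ih =>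
    rw [Finset.prod_insert ha, Finset.prod_insert ha, reverse_mul_of_domain, ih]

/-- `reverse (c X - β) = c - β X` for `c ≠ 0`. [folklore] -/
private theorem reverse_C_mul_X_sub_C {R : Type*} [CommRing R] {c : R} (hc : c ≠ 0) (β : R) :
    (C c * X - C β).reverse = C c - C β * X := by
  rw [sub_eq_add_neg, ← C_neg, reverse_add_C, reverse_mul_X, reverse_C, natDegree_C_mul_X _ hc,
    pow_one, C_neg, neg_mul, ← sub_eq_add_neg]

/-- **The monic `c`-reciprocal transform of a split polynomial.**  If `P = ∏ᵢ (X - βᵢ)` with all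
`βᵢ ≠ 0` and `c ≠ 0`, then `P(0)⁻¹ · reverse(P(cX)) = ∏ᵢ (X - c/βᵢ)`: the right-hand side of
clause (2) of `IsOccultSystem` (with `c = (N v)³`) is the monic polynomial whose roots are the
`c/βᵢ` — the shape in which Poincaré duality `H³_ω × H³_ω̄ → E_ℓ(-3)` delivers the Frobenius
eigenvalues at the conjugate place.  Ref: Allcock–Carlson–Toledo (2002), (2.3)–(2.4).
[folklore] -/
theorem C_inv_coeff_zero_mul_reverse_comp_prod_X_sub_C {E : Type*} [Field E] {ι : Type*}
    (s : Finset ι) (β : ι → E) (hβ : ∀ i ∈ s, β i ≠ 0) {c : E} (hc : c ≠ 0) :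
    C ((∏ i ∈ s, (X - C (β i))).coeff 0)⁻¹ *
        ((∏ i ∈ s, (X - C (β i))).comp (C c * X)).reverse =
      ∏ i ∈ s, (X - C (c / β i)) := by
  have h0 : (∏ i ∈ s, (X - C (β i))).coeff 0 = ∏ i ∈ s, (-β i) := by
    rw [coeff_zero_eq_eval_zero, eval_prod]
    simp
  have hne : (∏ i ∈ s, (-β i)) ≠ 0 :=
    Finset.prod_ne_zero_iff.mpr fun i hi => neg_ne_zero.mpr (hβ i hi)
  have hrev : ((∏ i ∈ s, (X - C (β i))).comp (C c * X)).reverse =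
      C (∏ i ∈ s, (-β i)) * ∏ i ∈ s, (X - C (c / β i)) := by
    rw [prod_comp, reverse_prod, map_prod C, ← Finset.prod_mul_distrib]
    refine Finset.prod_congr rfl fun i hi => ?_
    have hb : β i ≠ 0 := hβ i hi
    have key : β i * (c / β i) = c := by field_simp
    rw [sub_comp, X_comp, C_comp, reverse_C_mul_X_sub_C hc]
    calc C c - C (β i) * X = C (β i * (c / β i)) - C (β i) * X := by rw [key]
      _ = C (-β i) * (X - C (c / β i)) := by rw [C_mul, C_neg]; ring
  rw [hrev, h0, ← mul_assoc, ← C_mul, inv_mul_cancel₀ hne, C_1, one_mul]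

variable {F : MvPolynomial (Fin 4) ℚ}
  {𝓢 : CompatibleSystem (CyclotomicField 3 ℚ) (CyclotomicField 3 ℚ) 5}

/-- **Roots at the conjugate place.**  If the Frobenius polynomial of an occult system at a good
place `v` splits as `∏ᵢ (X - βᵢ)` with `βᵢ ≠ 0`, then at the conjugate good place `w = τ⁻¹ v` it
is `∏ᵢ (X - (N v)³/βᵢ)` (clause (2) unfolded through
`C_inv_coeff_zero_mul_reverse_comp_prod_X_sub_C`).  Ref: Allcock–Carlson–Toledo (2002),
(2.3)–(2.4); Kudla–Rapoport (2012), §5. [cite: AllcockCarlsonToledo2002, (2.3)–(2.4)] -/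
theorem IsOccultSystem.charpoly_conj_eq_prod (h : IsOccultSystem F 𝓢)
    {τ : (CyclotomicField 3 ℚ) ≃ₐ[ℚ] (CyclotomicField 3 ℚ)} (hτ : τ ≠ AlgEquiv.refl)
    {v w : HeightOneSpectrum (𝓞 (CyclotomicField 3 ℚ))} (hv : v ∉ 𝓢.bad) (hw : w ∉ 𝓢.bad)
    (hvw : w.asIdeal = Ideal.comap (RingOfIntegers.mapRingHom τ.toRingEquiv.toRingHom) v.asIdeal)
    {ι : Type*} {s : Finset ι} {β : ι → CyclotomicField 3 ℚ} (hβ : ∀ i ∈ s, β i ≠ 0)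
    (hP : 𝓢.charpoly v = ∏ i ∈ s, (X - C (β i))) :
    𝓢.charpoly w =
      ∏ i ∈ s, (X - C ((v.residueCard : CyclotomicField 3 ℚ) ^ 3 / β i)) := by
  rw [h.polarised hτ hv hw hvw, hP]
  refine C_inv_coeff_zero_mul_reverse_comp_prod_X_sub_C s β hβ (pow_ne_zero 3 ?_)
  have := v.one_lt_residueCard
  exact Nat.cast_ne_zero.mpr (by omega)

end Reciprocal

/-! #### Conjugate places have the same norm (`N w = N v` in clause (2)) -/

section ConjugatePlaces

/-- **Conjugate finite places have the same residue cardinality.**  If `w = τ⁻¹ v`, i.e.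
`𝔭_w = τ⁻¹(𝔭_v)` written as `w.asIdeal = comap (τ|𝓞_K) v.asIdeal` (the relation between the
two places in clause (2) of `IsOccultSystem`), then `N w = N v`: `τ|𝓞_K` induces
`𝓞_K/𝔭_w ≃ 𝓞_K/𝔭_v`.  Ref: Cassels–Fröhlich, *Algebraic Number Theory* (1967), Ch. VII §1.1.
[folklore] -/
theorem residueCard_eq_of_asIdeal_eq_comap {K : Type*} [Field K] [NumberField K]
    (τ : K ≃ₐ[ℚ] K) {v w : HeightOneSpectrum (𝓞 K)}
    (hvw : w.asIdeal = Ideal.comap (RingOfIntegers.mapRingHom τ.toRingEquiv.toRingHom) v.asIdeal) :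
    w.residueCard = v.residueCard := by
  set e : 𝓞 K ≃+* 𝓞 K := RingOfIntegers.mapRingEquiv τ.toRingEquiv with he
  have hg : ((e : 𝓞 K ≃+* 𝓞 K) : 𝓞 K →+* 𝓞 K) =
      RingOfIntegers.mapRingHom τ.toRingEquiv.toRingHom :=
    RingHom.ext fun _ => rfl
  have hsurj : Function.Surjective ((e : 𝓞 K ≃+* 𝓞 K) : 𝓞 K →+* 𝓞 K) := fun y =>
    ⟨e.symm y, by simp⟩
  have hmap : v.asIdeal = Ideal.map ((e : 𝓞 K ≃+* 𝓞 K) : 𝓞 K →+* 𝓞 K) w.asIdeal := by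
    rw [hvw, ← hg, Ideal.map_comap_of_surjective _ hsurj]
  rw [HeightOneSpectrum.residueCard_eq_card_quotient, HeightOneSpectrum.residueCard_eq_card_quotient]
  exact Nat.card_congr (Ideal.quotientEquiv w.asIdeal v.asIdeal e hmap).toEquiv

variable {F : MvPolynomial (Fin 4) ℚ}
  {𝓢 : CompatibleSystem (CyclotomicField 3 ℚ) (CyclotomicField 3 ℚ) 5}

/-- In clause (2) of an occult system the two places have the same norm, so the polarisation may
equally be written with `(N w)³`.  Ref: Allcock–Carlson–Toledo (2002), (2.3)–(2.4).
[cite: AllcockCarlsonToledo2002, (2.3)–(2.4)] -/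
theorem IsOccultSystem.polarised' (h : IsOccultSystem F 𝓢)
    {τ : (CyclotomicField 3 ℚ) ≃ₐ[ℚ] (CyclotomicField 3 ℚ)} (hτ : τ ≠ AlgEquiv.refl)
    {v w : HeightOneSpectrum (𝓞 (CyclotomicField 3 ℚ))} (hv : v ∉ 𝓢.bad) (hw : w ∉ 𝓢.bad)
    (hvw : w.asIdeal = Ideal.comap (RingOfIntegers.mapRingHom τ.toRingEquiv.toRingHom) v.asIdeal) :
    𝓢.charpoly w = C ((𝓢.charpoly v).coeff 0)⁻¹ *
      ((𝓢.charpoly v).comp (C ((w.residueCard : (CyclotomicField 3 ℚ)) ^ 3) * X)).reverse := by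
  rw [residueCard_eq_of_asIdeal_eq_comap τ hvw]
  exact h.polarised hτ hv hw hvw

end ConjugatePlaces

/-- **Clause (3) does not see the difference between a Frobenius and its inverse.**  For a cubic
form `F` over `ℚ`, a basis `b` of the quadratic space of its lines over `ℚ̄`, any
`j : 𝔽₃ →+* 𝓞_E/λ` and any `σ ∈ Γ_K` (`K = ℚ(ω)`), the reduced Frobenius-type polynomial of
clause (3) of `IsOccultSystem` is the same for `σ` and `σ⁻¹` — so the clause may be read with
arithmetic or geometric Frobenius indifferently.  Ref: Allcock–Carlson–Toledo (2002), (2.12).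
[cite: AllcockCarlsonToledo2002, (2.12)] -/
theorem charpoly_toMatrix_linesQuadRep_absGaloisRestrict_inv (F : MvPolynomial (Fin 4) ℚ)
    {ι : Type*} [Fintype ι] [DecidableEq ι]
    (b : Module.Basis ι (ZMod 3) (LinesQuadSpace (AlgebraicClosure ℚ) F))
    («λ» : HeightOneSpectrum (𝓞 (CyclotomicField 3 ℚ)))
    (j : ZMod 3 →+* 𝓞 (CyclotomicField 3 ℚ) ⧸ «λ».asIdeal)
    (σ : absoluteGaloisGroup (CyclotomicField 3 ℚ)) :
    (LinearMap.toMatrix b b (linesQuadRep (AlgebraicClosure ℚ) F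
        (absGaloisRestrict ℚ (CyclotomicField 3 ℚ) σ⁻¹))).charpoly.map j =
      (LinearMap.toMatrix b b (linesQuadRep (AlgebraicClosure ℚ) F
        (absGaloisRestrict ℚ (CyclotomicField 3 ℚ) σ))).charpoly.map j := by
  rw [map_inv, charpoly_toMatrix_linesQuadRep_inv]

/-! ## Clause (3) through a marking of the `27` lines

With a marking `m` of the lines of `F` over `ℚ̄` (`CubicSurface.SchlafliMarking`, file
`SchlafliFrame.lean`: the linear-algebra half of the theorem of the `27` lines), the basis `b`
demanded by the residual clause of `IsOccultSystem` is `m.basis` (`[E_i] - [F_{i5}]`,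
[Achter2014, Lemma 4.4]) and the matrix of `σ ∈ Γ_K` on `V(S)` in it is the explicit
`frameMatrix (m.perm σ')`, `σ' = σ|_{ℚ̄}` (`SchlafliMarking.toMatrix_linesQuadRep`).  Hence:
**clause (3) is a statement about the permutation action of Frobenius on the `27` lines**, in
both directions — it can be established from a marking and integral lifts whose reductions are
the characteristic polynomials of the matrices `frameMatrix (m.perm Frob)`
(`isOccultSystem_of_marking`), and conversely an occult system computes those characteristic
polynomials for every marking (`IsOccultSystem.residual_frameMatrix`).  This is the form in which
[Achter2014, Prop 4.5] (the `W(E₆)`-equivariant identification of marked cubics with the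
`(1 - ζ₃)`-torsion of the Prym) enters the discharge of `CubicSurface.exists_occultSystem`. -/

section ResidualOfMarking

variable {F : MvPolynomial (Fin 4) ℚ}
  {𝓢 : CompatibleSystem (CyclotomicField 3 ℚ) (CyclotomicField 3 ℚ) 5}

/-- **Clause (3) from a marking.**  Given a marking `m` of the lines of `F` over `ℚ̄`, a prime
`λ ∋ 3` of `𝓞_E` with `j : 𝔽₃ →+* 𝓞_E/λ`, and for every good `v` an integral lift `P₀` of
`charpoly v` reducing modulo `λ` to the characteristic polynomial of `frameMatrix (m.perm Frob)`
for every arithmetic Frobenius at every prime above `v`, the residual clause (3) of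
`IsOccultSystem F 𝓢` holds with `b = m.basis`.
Ref: Achter (2014), Lemma 4.4, Prop 4.5. [cite: Achter2014, Lemma 4.4, Prop 4.5] -/
theorem residual_of_marking (m : SchlafliMarking (AlgebraicClosure ℚ) F)
    («λ» : HeightOneSpectrum (𝓞 (CyclotomicField 3 ℚ)))
    (j : ZMod 3 →+* 𝓞 (CyclotomicField 3 ℚ) ⧸ «λ».asIdeal)
    (h3 : (3 : 𝓞 (CyclotomicField 3 ℚ)) ∈ «λ».asIdeal)
    (H : ∀ v : HeightOneSpectrum (𝓞 (CyclotomicField 3 ℚ)), v ∉ 𝓢.bad →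
      ∃ P₀ : Polynomial (𝓞 (CyclotomicField 3 ℚ)),
        P₀.map (algebraMap (𝓞 (CyclotomicField 3 ℚ)) (CyclotomicField 3 ℚ)) = 𝓢.charpoly v ∧
        ∀ 𝔓 ∈ v.primesAbove, ∀ σ : absoluteGaloisGroup (CyclotomicField 3 ℚ),
          IsArithFrobAt (𝓞 (CyclotomicField 3 ℚ)) σ 𝔓 →
          (SchlafliMarking.frameMatrix
              (m.perm (absGaloisRestrict ℚ (CyclotomicField 3 ℚ) σ))).charpoly.map j =
            P₀.map (Ideal.Quotient.mk «λ».asIdeal)) :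
    ∃ («λ» : HeightOneSpectrum (𝓞 (CyclotomicField 3 ℚ)))
      (j : ZMod 3 →+* 𝓞 (CyclotomicField 3 ℚ) ⧸ «λ».asIdeal)
      (b : Module.Basis (Fin 5) (ZMod 3) (LinesQuadSpace (AlgebraicClosure ℚ) F)),
    (3 : 𝓞 (CyclotomicField 3 ℚ)) ∈ «λ».asIdeal ∧
    ∀ v : HeightOneSpectrum (𝓞 (CyclotomicField 3 ℚ)), v ∉ 𝓢.bad →
      ∃ P₀ : Polynomial (𝓞 (CyclotomicField 3 ℚ)),
        P₀.map (algebraMap (𝓞 (CyclotomicField 3 ℚ)) (CyclotomicField 3 ℚ)) = 𝓢.charpoly v ∧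
        ∀ 𝔓 ∈ v.primesAbove, ∀ σ : absoluteGaloisGroup (CyclotomicField 3 ℚ),
          IsArithFrobAt (𝓞 (CyclotomicField 3 ℚ)) σ 𝔓 →
          (LinearMap.toMatrix b b (linesQuadRep (AlgebraicClosure ℚ) F
              (absGaloisRestrict ℚ (CyclotomicField 3 ℚ) σ))).charpoly.map j =
            P₀.map (Ideal.Quotient.mk «λ».asIdeal) := by
  refine ⟨«λ», j, m.basis, h3, fun v hv => ?_⟩
  obtain ⟨P₀, hP₀, hFrob⟩ := H v hv
  refine ⟨P₀, hP₀, fun 𝔓 h𝔓 σ hσ => ?_⟩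
  rw [m.charpoly_toMatrix_linesQuadRep]
  exact hFrob 𝔓 h𝔓 σ hσ

/-- **Assembly of an occult system from a marking.**  Purity (1), polarisation (2) and the
marked form of the residual data (as in `residual_of_marking`) give `IsOccultSystem F 𝓢`.
[cite: Achter2014, Lemma 4.4, Prop 4.5] -/
theorem isOccultSystem_of_marking (m : SchlafliMarking (AlgebraicClosure ℚ) F)
    (h1 : ∀ v : HeightOneSpectrum (𝓞 (CyclotomicField 3 ℚ)), v ∉ 𝓢.bad →
      ∀ (emb : (CyclotomicField 3 ℚ) →+* ℂ) (z : ℂ), ((𝓢.charpoly v).map emb).IsRoot z →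
        ‖z‖ ^ 2 = (v.residueCard : ℝ) ^ 3)
    (h2 : ∀ τ : (CyclotomicField 3 ℚ) ≃ₐ[ℚ] (CyclotomicField 3 ℚ), τ ≠ AlgEquiv.refl →
      ∀ v w : HeightOneSpectrum (𝓞 (CyclotomicField 3 ℚ)), v ∉ 𝓢.bad → w ∉ 𝓢.bad →
        w.asIdeal = Ideal.comap (RingOfIntegers.mapRingHom τ.toRingEquiv.toRingHom) v.asIdeal →
        𝓢.charpoly w = C ((𝓢.charpoly v).coeff 0)⁻¹ *
          ((𝓢.charpoly v).comp (C ((v.residueCard : (CyclotomicField 3 ℚ)) ^ 3) * X)).reverse)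
    («λ» : HeightOneSpectrum (𝓞 (CyclotomicField 3 ℚ)))
    (j : ZMod 3 →+* 𝓞 (CyclotomicField 3 ℚ) ⧸ «λ».asIdeal)
    (h3 : (3 : 𝓞 (CyclotomicField 3 ℚ)) ∈ «λ».asIdeal)
    (H : ∀ v : HeightOneSpectrum (𝓞 (CyclotomicField 3 ℚ)), v ∉ 𝓢.bad →
      ∃ P₀ : Polynomial (𝓞 (CyclotomicField 3 ℚ)),
        P₀.map (algebraMap (𝓞 (CyclotomicField 3 ℚ)) (CyclotomicField 3 ℚ)) = 𝓢.charpoly v ∧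
        ∀ 𝔓 ∈ v.primesAbove, ∀ σ : absoluteGaloisGroup (CyclotomicField 3 ℚ),
          IsArithFrobAt (𝓞 (CyclotomicField 3 ℚ)) σ 𝔓 →
          (SchlafliMarking.frameMatrix
              (m.perm (absGaloisRestrict ℚ (CyclotomicField 3 ℚ) σ))).charpoly.map j =
            P₀.map (Ideal.Quotient.mk «λ».asIdeal)) :
    IsOccultSystem F 𝓢 :=
  ⟨h1, h2, residual_of_marking m «λ» j h3 H⟩

/-- **An occult system computes the Frobenius polynomials on the `27` lines.**  Conversely, if
`𝓢` is an occult system for `F`, then for EVERY marking `m` of the lines of `F` over `ℚ̄` there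
are `λ ∋ 3` and `j` such that at every good `v` some integral lift of `charpoly v` reduces to the
characteristic polynomial of the explicit matrix `frameMatrix (m.perm Frob)` — the residual
clause does not depend on the basis, only on the permutation action of `Γ_K` on the lines.
[cite: AllcockCarlsonToledo2002, (4.8)–(4.10)] -/
theorem IsOccultSystem.residual_frameMatrix (h : IsOccultSystem F 𝓢)
    (m : SchlafliMarking (AlgebraicClosure ℚ) F) :
    ∃ («λ» : HeightOneSpectrum (𝓞 (CyclotomicField 3 ℚ)))
      (j : ZMod 3 →+* 𝓞 (CyclotomicField 3 ℚ) ⧸ «λ».asIdeal),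
    (3 : 𝓞 (CyclotomicField 3 ℚ)) ∈ «λ».asIdeal ∧
    ∀ v : HeightOneSpectrum (𝓞 (CyclotomicField 3 ℚ)), v ∉ 𝓢.bad →
      ∃ P₀ : Polynomial (𝓞 (CyclotomicField 3 ℚ)),
        P₀.map (algebraMap (𝓞 (CyclotomicField 3 ℚ)) (CyclotomicField 3 ℚ)) = 𝓢.charpoly v ∧
        ∀ 𝔓 ∈ v.primesAbove, ∀ σ : absoluteGaloisGroup (CyclotomicField 3 ℚ),
          IsArithFrobAt (𝓞 (CyclotomicField 3 ℚ)) σ 𝔓 →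
          (SchlafliMarking.frameMatrix
              (m.perm (absGaloisRestrict ℚ (CyclotomicField 3 ℚ) σ))).charpoly.map j =
            P₀.map (Ideal.Quotient.mk «λ».asIdeal) := by
  obtain ⟨«λ», j, b, h3, H⟩ := h.residual
  refine ⟨«λ», j, h3, fun v hv => ?_⟩
  obtain ⟨P₀, hP₀, hFrob⟩ := H v hv
  refine ⟨P₀, hP₀, fun 𝔓 h𝔓 σ hσ => ?_⟩
  rw [← m.charpoly_toMatrix_linesQuadRep_of_basis b]
  exact hFrob 𝔓 h𝔓 σ hσ

/-- In an occult system the polynomial of clause (3) attached to `σ ∈ Γ_K` depends only on the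
permutation of the `27` lines induced by `σ` (for any marking `m`): elements inducing the same
permutation — e.g. differing by an element fixing every line — give the same reduced polynomial.
[folklore] -/
theorem charpoly_toMatrix_linesQuadRep_absGaloisRestrict_congr
    (m : SchlafliMarking (AlgebraicClosure ℚ) F)
    (b : Module.Basis (Fin 5) (ZMod 3) (LinesQuadSpace (AlgebraicClosure ℚ) F))
    {σ τ : absoluteGaloisGroup (CyclotomicField 3 ℚ)}
    (hστ : m.perm (absGaloisRestrict ℚ (CyclotomicField 3 ℚ) σ) =
      m.perm (absGaloisRestrict ℚ (CyclotomicField 3 ℚ) τ)) :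
    (LinearMap.toMatrix b b (linesQuadRep (AlgebraicClosure ℚ) F
        (absGaloisRestrict ℚ (CyclotomicField 3 ℚ) σ))).charpoly =
      (LinearMap.toMatrix b b (linesQuadRep (AlgebraicClosure ℚ) F
        (absGaloisRestrict ℚ (CyclotomicField 3 ℚ) τ))).charpoly :=
  m.charpoly_toMatrix_linesQuadRep_congr b hστ

end ResidualOfMarking

end CubicSurface

end Literature.AlgebraicGeometry.CubicSurfaces

end
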